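import Literature.AlgebraicGeometry.Frobenioids.ModelFrobenioidPreFrobenioid
import Literature.AlgebraicGeometry.Frobenioids.ModelFrobenioidCofinal
import HarnessLib

/-!
# Frobenioids I, Proposition 1.10 (vi) for MODEL CATEGORIES, without the Frobenioid axioms:
# every object of a model Frobenioid with group-like `B` is sub-quasi-Frobenius-trivial

Mochizuki, *The geometry of Frobenioids I: the general theory*, Kyushu J. Math. **62** (2008) 293–400,
§1, Definition 1.2 (iv), kurims pp. 23–24 ("quasi-Frobenius-trivial": base-identity endomorphisms of
every Frobenius degree; "sub-quasi-Frobenius-trivial": "there exists a co-angular pre-step `B → A` such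
that `B` is quasi-Frobenius-trivial") [cite: MochizukiFrdI2008, Def. 1.2(iv)], and Proposition 1.10 (vi)
p. 35 ("if `C` is of isotropic type, then every object of `C` is sub-quasi-Frobenius-trivial")
[cite: MochizukiFrdI2008, Prop. 1.10(vi) p.35], for the model category `C = ModelFrobenioid Φ B Div_B`
of the data of Theorem 5.2 (i) p. 100 [cite: MochizukiFrdI2008, Thm. 5.2(i) p.100].

PROOF-ONLY file (no definitions; abc-iut cell, seat abc-iut-f-047, FLOAT on FACT-LIST row F-0743 [EtTh]
Thm. 3.7 (i)). In the tree, Prop. 1.10 (vi) is proved for FROBENIOIDS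
(`PreFrobenioid.isOfType_isSubQuasiFrobeniusTrivial_of_isOfIsotropicType`, input `hF`), and the model
Frobenioid is quasi-Frobenius-trivial only under the cofinality of `Div_B`
(`ModelFrobenioid.isQuasiFrobeniusTrivial_of_cofinal`). Here, for ANY data `(D, Φ, B, Div_B)`:
* `isQuasiFrobeniusTrivial_mk_inv` — the "anti-effective" object `(A_D, −of(b))` is quasi-Frobenius-trivial:
  `(n, id, (n−1)·b, 0)` is a base-identity endomorphism of Frobenius degree `n`, for every `n ≥ 1`
  (no hypothesis at all);
* `isSubQuasiFrobeniusTrivial` — if the rational function monoids `B(A)` are group-like, EVERY object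
  `X = (X_D, ξ)`, `ξ = of(a) − of(b)`, receives the pre-step `(1, id, a, 0) : (X_D, −of(b)) → X`, which is
  co-angular (every morphism of a model category with group-like `B` is, `ModelFrobenioid.isCoAngular`);
  hence `C` is of sub-quasi-Frobenius-trivial type (`isOfType_isSubQuasiFrobeniusTrivial`) — WITHOUT
  "`C` is a Frobenioid" (no "`Φ`, `B` monoids on `D`", no divisoriality, no cofinality).
Consumer: [EtTh] Thm. 3.7 (i), clause "of sub-quasi-Frobenius-trivial type", unconditionally
(`EtaleTheta/Discharge/Sec3Thm37SubQFTHolds.lean`). Nothing here bears on [IUTchIII] Cor. 3.12.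
-/

namespace Literature.AlgebraicGeometry.Frobenioids

namespace ModelFrobenioid

open CategoryTheory Opposite

universe w v u

variable {D : Type u} [Category.{v} D] {Φ B : Dᵒᵖ ⥤ CommMonCat.{w}} {DivB : B ⟶ monoidGp Φ}

/-- The anti-effective object `(A_D, −of(b))` of a model category is quasi-Frobenius-trivial: for every
`n ≥ 1`, `(n, id, (n−1)·b, 0)` is a base-identity endomorphism of Frobenius degree `n` (relation (d):
`n·(−b) + (n−1)·b = −b`). No hypothesis on the data. [cite: MochizukiFrdI2008, Def. 1.2(iv)] -/
theorem isQuasiFrobeniusTrivial_mk_inv (A : D) (b : Φ.obj (op A)) :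
    PreFrobenioid.IsQuasiFrobeniusTrivial (toElem Φ B DivB)
      (⟨A, (Algebra.GrothendieckGroup.of b)⁻¹⟩ : ModelFrobenioid Φ B DivB) := by
  intro n
  refine ⟨⟨n, 𝟙 A, b ^ n.natPred, 1, ?_⟩, rfl, rfl⟩
  show (Algebra.GrothendieckGroup.of b)⁻¹ ^ (n : ℕ) * Algebra.GrothendieckGroup.of (b ^ n.natPred) =
    pullGp Φ (𝟙 A) (Algebra.GrothendieckGroup.of b)⁻¹ * divB Φ B DivB (op A) 1
  rw [pullGp_id, map_one, mul_one, map_pow, ← PNat.natPred_add_one n, inv_pow, pow_succ,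
    inv_mul_eq_iff_eq_mul, mul_assoc, mul_inv_cancel, mul_one]

/-- **[FrdI] Prop. 1.10 (vi) for model categories, without the Frobenioid axioms**: if the rational
function monoids `B(A)` are group-like, every object `X = (X_D, ξ)` of the model category is
sub-quasi-Frobenius-trivial — writing `ξ = of(a) − of(b)`, the arrow `(1, id, a, 0) : (X_D, −of(b)) → X`
is a pre-step (linear, base-identity), co-angular (`isCoAngular`: isometric pre-steps of a model category
with group-like `B` are isomorphisms), out of the quasi-Frobenius-trivial object `(X_D, −of(b))`
(`isQuasiFrobeniusTrivial_mk_inv`). [cite: MochizukiFrdI2008, Prop. 1.10(vi) p.35] -/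
theorem isSubQuasiFrobeniusTrivial (hBg : Objectwise (fun M _ => IsGroupLike M) B)
    (X : ModelFrobenioid Φ B DivB) :
    PreFrobenioid.IsSubQuasiFrobeniusTrivial (toElem Φ B DivB) X := by
  obtain ⟨a, b, hab⟩ := grothendieckGroup_exists_mul_of_eq_of X.cls
  let ψ : (⟨X.base, (Algebra.GrothendieckGroup.of b)⁻¹⟩ : ModelFrobenioid Φ B DivB) ⟶ X :=
    { degFr := 1, base := 𝟙 X.base, div := a, unit := 1
      rel := by
        show (Algebra.GrothendieckGroup.of b)⁻¹ ^ ((1 : ℕ+) : ℕ) * Algebra.GrothendieckGroup.of a =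
          pullGp Φ (𝟙 X.base) X.cls * divB Φ B DivB (op X.base) 1
        rw [PNat.one_coe, pow_one, pullGp_id, map_one, mul_one, ← hab, mul_comm X.cls, ← mul_assoc,
          inv_mul_cancel, one_mul] }
  exact ⟨_, ψ, isCoAngular hBg ψ, ⟨rfl, show IsIso (𝟙 X.base) from inferInstance⟩,
    isQuasiFrobeniusTrivial_mk_inv X.base b⟩

/-- Hence a model category with group-like rational function monoids is **of sub-quasi-Frobenius-trivial
type** — the conclusion of [FrdI] Prop. 1.10 (vi), for model categories without the Frobenioid axioms.
[cite: MochizukiFrdI2008, Prop. 1.10(vi) p.35] -/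
theorem isOfType_isSubQuasiFrobeniusTrivial (hBg : Objectwise (fun M _ => IsGroupLike M) B) :
    PreFrobenioid.IsOfType (PreFrobenioid.IsSubQuasiFrobeniusTrivial (toElem Φ B DivB)) :=
  fun X => isSubQuasiFrobeniusTrivial hBg X

end ModelFrobenioid

end Literature.AlgebraicGeometry.Frobenioids
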